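import Mathlib

/-! # `Balaban1983to89.SchurTestNormed` — the finite Schur test over `ℂ` (or any `RCLike` field)

CITATION HEADER. Companion of `SchurTest.lean` (unit `b2b-balaban-adv1`, cell pub-balaban) for the COMPLEX case needed
at T. Balaban, Commun. Math. Phys. 99 (1985) 389–434 [`Balaban1985BackgroundPropagators`], Thm 3.1 (3.46): the block
propagator `χ_{Δ(y)} G′ χ_{Δ(y′)}` is a complex matrix (covariant Laplacian with unitary `U`, Hermitian), so the
ℓ¹×ℓ∞ ⇒ ℓ² interpolation must be stated with moduli: `Σ_i ‖Σ_j T i j x j‖² ≤ R C Σ_j ‖x j‖²` whenever the rows of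
`‖T‖` sum to ≤ R and the columns to ≤ C.  With `R = ‖T‖_{∞→∞}` from (3.42) and `C = ‖T^*‖_{∞→∞}` from (3.42) applied
to the adjoint block (`G′` Hermitian, `(∇G′)^* = G′∇^*`), this derives (3.46) entries 1–3 from (3.42); entries 4–6 are
not covered (GAPS G-A1-1).  [folklore] (Schur test). -/

namespace Literature.MathematicalPhysics.QuantumFieldTheory.Balaban1983to89.SchurTestNormed

open Finset

variable {ι : Type*} [Fintype ι] {𝕜 : Type*} [RCLike 𝕜]

/-- Row-wise Cauchy–Schwarz with the weights `‖T i j‖`. [folklore] -/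
theorem row_sq_le (T : ι → ι → 𝕜) (x : ι → 𝕜) (i : ι) :
    ‖∑ j, T i j * x j‖ ^ 2 ≤ (∑ j, ‖T i j‖) * ∑ j, ‖T i j‖ * ‖x j‖ ^ 2 := by
  have h1 : ‖∑ j, T i j * x j‖ ^ 2 ≤ (∑ j, ‖T i j‖ * ‖x j‖) ^ 2 := by
    have ha : ‖∑ j, T i j * x j‖ ≤ ∑ j, ‖T i j‖ * ‖x j‖ := by
      calc ‖∑ j, T i j * x j‖ ≤ ∑ j, ‖T i j * x j‖ := norm_sum_le _ _
        _ = ∑ j, ‖T i j‖ * ‖x j‖ := by simp [norm_mul]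
    gcongr
  have h2 : (∑ j, ‖T i j‖ * ‖x j‖) ^ 2 ≤ (∑ j, ‖T i j‖) * ∑ j, ‖T i j‖ * ‖x j‖ ^ 2 := by
    have hcs := Finset.sum_mul_sq_le_sq_mul_sq (univ : Finset ι)
      (fun j => Real.sqrt ‖T i j‖) (fun j => Real.sqrt ‖T i j‖ * ‖x j‖)
    have e1 : ∀ j, Real.sqrt ‖T i j‖ * (Real.sqrt ‖T i j‖ * ‖x j‖) = ‖T i j‖ * ‖x j‖ := by
      intro j; rw [← mul_assoc, Real.mul_self_sqrt (norm_nonneg _)]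
    have e2 : ∀ j, Real.sqrt ‖T i j‖ ^ 2 = ‖T i j‖ := fun j => Real.sq_sqrt (norm_nonneg _)
    have e3 : ∀ j, (Real.sqrt ‖T i j‖ * ‖x j‖) ^ 2 = ‖T i j‖ * ‖x j‖ ^ 2 := by
      intro j; rw [mul_pow, Real.sq_sqrt (norm_nonneg _)]
    simp only [e1, e2, e3] at hcs
    exact hcs
  exact h1.trans h2

/-- **Finite Schur test (normed).** `Σ_i ‖(T x)_i‖² ≤ R C Σ_j ‖x_j‖²` from row sums ≤ R and column sums ≤ C
of `‖T i j‖`. [folklore] -/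
theorem sum_sq_le (T : ι → ι → 𝕜) (x : ι → 𝕜) {R C : ℝ}
    (hR : ∀ i, ∑ j, ‖T i j‖ ≤ R) (hC : ∀ j, ∑ i, ‖T i j‖ ≤ C) :
    ∑ i, ‖∑ j, T i j * x j‖ ^ 2 ≤ R * C * ∑ j, ‖x j‖ ^ 2 := by
  rcases isEmpty_or_nonempty ι with h | ⟨⟨i₀⟩⟩
  · simp
  have hR0 : 0 ≤ R := le_trans (Finset.sum_nonneg fun j _ => norm_nonneg _) (hR i₀)
  calc ∑ i, ‖∑ j, T i j * x j‖ ^ 2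
      ≤ ∑ i, (∑ j, ‖T i j‖) * ∑ j, ‖T i j‖ * ‖x j‖ ^ 2 := Finset.sum_le_sum fun i _ => row_sq_le T x i
    _ ≤ ∑ i, R * ∑ j, ‖T i j‖ * ‖x j‖ ^ 2 := by
        refine Finset.sum_le_sum fun i _ => ?_
        exact mul_le_mul_of_nonneg_right (hR i) (Finset.sum_nonneg fun j _ => by positivity)
    _ = R * ∑ j, ‖x j‖ ^ 2 * ∑ i, ‖T i j‖ := by
        rw [← Finset.mul_sum, Finset.sum_comm]
        congr 1
        refine Finset.sum_congr rfl fun j _ => ?_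
        rw [Finset.mul_sum]
        refine Finset.sum_congr rfl fun i _ => ?_
        ring
    _ ≤ R * ∑ j, ‖x j‖ ^ 2 * C := by
        refine mul_le_mul_of_nonneg_left (Finset.sum_le_sum fun j _ => ?_) hR0
        exact mul_le_mul_of_nonneg_left (hC j) (sq_nonneg _)
    _ = R * C * ∑ j, ‖x j‖ ^ 2 := by rw [← Finset.sum_mul]; ring

end Literature.MathematicalPhysics.QuantumFieldTheory.Balaban1983to89.SchurTestNormed
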